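import Mathlib

/-!
# EriceRemainderEnclosureHistoryAutonomyComparisonAgeCompositionCascade — (E95a) route (N), first order: THE MULTIPLICATIVE RESIDUAL CASCADE (pure).
# A renewal system `ε = e − Σ_{j<r} O^j(ε)` read by ANY NUMBER `r` of non-negative windows of lengths `a_0 < a_1 < … < a_{r−1}` in
# GEOMETRIC SEPARATION `a_{j+1} ≥ R₀·a_j` is non-negative, `0 ≤ ε ≤ e`, WHATEVER THE TOTAL MASS `Σ_j s_j` (which may exceed `1` by any
# amount), as soon as (i) each window's row sum is at most its load `a_j·c_j ≤ s` (`s·(1+κ) < 1`), and (ii) each read varies across `d`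
# pins by at most `4·c_j·d·T` whenever its OWN targets are bounded by `T` — the RELATIVE form of (E91a) `old_read_variation` — with the one
# closure inequality `κ + 4s(1+κ) ≤ R₀·(1 − s(1+κ))·κ`.  The residual left by the ages `≥ j`, `B_j = e − Σ_{j'≥j} O^{j'}`, contracts by at
# most the factor `1 − s(1+κ)` per age and the variation RATE of the older reads, `U_j = Σ_{j'>j} 4c_{j'}(1+κ)B_{j'+1}`, stays below
# `κ·B_{j+1}∕a_j`: a recursion that is UNIFORM IN THE NUMBER OF AGES (the additive wedge of (E92a) `residual_step`, iterated, is not —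
# its error is measured against `e`, the residual against which it must be small decays geometrically in the number of older ages)

Cell `pub-balaban`, β-function sub-cell, BINDER row D4 «RemainderConst leaves for Bałaban's split» (`HOME/BINDER-OWNERS.md`; owner lineage `b2b-balaban-beta-an4`;
this file by co-owner #2 lineage `b2b-balaban-beta-d4-p2`, generation 85), β-FLOW TEAM duty (1), FREEZE (0) honoured (def-free; Mathlib only; nothing restated).
Sequel of (E91b) `…TwoAgesFar` §1 `renewal_nonneg_two_reads` and (E92a) `…NestedReads` §1 `residual_step` (same abstract renewal language).

HONEST FRAMING (page 1, verbatim and binding).  *"Discharging BetaPertH makes Bałaban's UV stability UNCONDITIONAL — a real constructive-QFT result; it is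
NOT the continuum limit and NOT the Clay problem."*  THIS FILE DISCHARGES NOTHING OF THE KIND.  Elementary real algebra about ABSTRACT real sequences and
triangular renewal systems — hypotheses of a census, not facts; the form, signs, ages and moments of Bałaban's (1.22) limit functional are NOT PRINTED
([I] p. 298; GAPS G-t4-U2-1∕-2) and NOT asserted.  Row D4 class UNCHANGED (critical-path width 0; instance 0∕1; D4 DISCHARGE NO DATE).  HONEST DEPENDENCY:
continuum YM on T⁴ ⇐ BetaPertH ∧ nine spine estimates (0/9 proved); BetaPertH ⇐ (D1) ∧ (D4) ∧ CAP+tail; G-an2-4 gates asym, D1 and NE2/3/4.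

THE POINT (README `HOME/b2b-balaban-beta-d4-p2/g85/README.md`).  Every END of route (N) in the tree concerns AT MOST THREE loaded ages ((E91b) two ages at
every ratio; (E94m) `flow_nonneg_census_three_ages_all`); the nested wedge (E92a) `residual_step` — «young contraction against a slowly varying older read,
residual in, residual out» — is iterable, but its slow-variation error `sy·V·e` is measured against the EXCESS `e`, while the residual it must not exceed
is `≈ Π_{j'>j}(1 − s_{j'})·e`: with `r` ages the iterated wedge needs separations growing like `(1 − s)^{−r}`.  Here the variation hypothesis is taken
in RELATIVE form — the read of age `j` moves across `d ≤ a_j` pins by `≤ 4c_j·d·T` when ITS OWN targets (the `a_j` scales beyond the pin) are `≤ T`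
(this is what (E91a)'s proof actually shows; the flow form is (E95b) `old_read_variation_of_bound`) — and the bookkeeping is MULTIPLICATIVE: at the pin
`m`, under the induction hypothesis `0 ≤ ε ≤ e` beyond `m`, with `B_j := e_m − Σ_{j'≥j} O^{j'}_m` (`B_r = e_m`, `B_0 = ε_m`), `C := 1 + κ` and the
variation rate `U_j := Σ_{j'>j} 4c_{j'}·C·B_{j'+1}`, the invariant «`B_{j'} ≥ 0` (`j' ≥ j`), the targets of age `j'` are `≤ C·B_{j'+1}` (`j' ≥ j`),
`a_{j−1}·U_{j−1} ≤ κ·B_j`» descends from `j = r` to `j = 1`: the targets of age `j` carry every older read, each of which has moved by at most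
`4c_{j'}·a_j·C·B_{j'+1}` since the pin, in total `≤ a_j·U_j ≤ κB_{j+1}`, so they are `≤ (1+κ)B_{j+1}`; hence `O^j_m ≤ s·C·B_{j+1}` and
`B_j ≥ (1 − sC)·B_{j+1}`; and `a_{j−1}·U_{j−1} ≤ (a_j∕R₀)(U_j + 4c_j·C·B_{j+1}) ≤ (κ + 4sC)∕R₀ · B_{j+1} ≤ (κ + 4sC)∕(R₀(1 − sC)) · B_j ≤ κB_j`.  The
youngest age needs only `s₀·C ≤ 1` (`s₀` its own cap).  With `κ = 1∕4`: `s = 0.6142` (the own-window cap of (E94b) `load_le_of_sq`, ages `≥ 56`) gives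
`R₀ ≥ 57.2`; `s = √2∕2` gives `R₀ ≥ 131`.  CONSEQUENCE ((E95b)): the END for `{a_0, …, a_{r−1}}` with `a_{j+1} ≥ 58·a_j`, EVERY `r` — the first END
of route (N) with an unbounded number of loaded ages, and the lower bound `ε_m ≥ (1 − s₀C)(1 − sC)^{r−1}·e_m`.
NOT CLAIMED: anything about near ages (ratios `< R₀`: (E90c)∕(E94) territory); anything nonlinear; anything printed — NOT B12 Thm 2, NOT BetaPertH.

WHAT IS PROVED ([folklore]; 0 `def`, 0 sorry).  §1 `cascade_level` (one age at one pin: targets bound and residual contraction from the invariant above it).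
§2 **`renewal_nonneg_cascade`** (the END for `r` separated reads, every `r`, every horizon, every total mass).
-/
noncomputable section
open Finset

namespace Summit.QuantumFields.BalabanUV.Beta.EriceRemainderEnclosureHistoryAutonomyComparisonAgeCompositionCascade

/-! ## §1 One level of the cascade -/

/-- **ONE LEVEL OF THE CASCADE (pure, one pin `m`, one age `j`).**  Reads `O j' q = Σ_{l<Kw} w j' q l·ε_{q+1+l}` with non-negative weights vanishing
for `l ≥ a j'` and row sums `≤ a_{j'}·c_{j'}(q)`; `ε_q = e_q − Σ_{j'<r} O j' q` at every pin, `0 ≤ ε ≤ e` beyond `m`, `e ≥ 0` non-increasing; window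
lengths `a j ≤ a j'` for `j < j' < r`; RELATIVE VARIATION: `O j' m − O j' (m+d) ≤ 4·c_{j'}(m)·d·T` whenever `1 ≤ d ≤ a j'`, `ε ≥ 0` beyond `m` and the
own targets `ε_q`, `m < q ≤ m + a j'`, are `≤ T` (`T ≥ 0`).  With the residuals `B j' = e_m − Σ_{i∈[j',r)} O i m` and `C ≥ 1`: IF `B j' ≥ 0` for
`j < j' ≤ r`, the targets of every older age `j' > j` are `≤ C·B (j'+1)`, and the accumulated variation `a_j·Σ_{j'∈(j,r)} 4c_{j'}(m)·C·B(j'+1)` is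
`≤ (C − 1)·B (j+1)`, THEN the targets of age `j` are `≤ C·B (j+1)` and `B j ≥ (1 − a_j c_j(m)·C)·B (j+1)`. [folklore] -/
theorem cascade_level {r Kw m j : ℕ} {C : ℝ} {a : ℕ → ℕ} {w : ℕ → ℕ → ℕ → ℝ} {c O : ℕ → ℕ → ℝ} {e ε B : ℕ → ℝ}
    (hjr : j < r) (hC : 1 ≤ C)
    (hw0 : ∀ j' q l, 0 ≤ w j' q l) (hwa : ∀ j' q l, a j' ≤ l → w j' q l = 0) (hc0 : ∀ j' q, 0 ≤ c j' q)
    (hrow : ∀ j' q, j' < r → ∑ l ∈ range Kw, w j' q l ≤ (a j' : ℝ) * c j' q)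
    (hO : ∀ j' q, O j' q = ∑ l ∈ range Kw, w j' q l * ε (q + 1 + l))
    (hamono : ∀ j', j < j' → j' < r → a j ≤ a j')
    (hvar : ∀ j' d (T : ℝ), j' < r → 1 ≤ d → d ≤ a j' → 0 ≤ T → (∀ q, m < q → 0 ≤ ε q) →
      (∀ q, m < q → q ≤ m + a j' → ε q ≤ T) → O j' m - O j' (m + d) ≤ 4 * c j' m * d * T)
    (hea : ∀ q, e (q + 1) ≤ e q) (hrec : ∀ q, ε q = e q - ∑ i ∈ range r, O i q)
    (IH : ∀ q, m < q → 0 ≤ ε q ∧ ε q ≤ e q)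
    (hB : ∀ j', B j' = e m - ∑ i ∈ Ico j' r, O i m)
    (hBnn : ∀ j', j < j' → j' ≤ r → 0 ≤ B j')
    (hT : ∀ j', j < j' → j' < r → ∀ q, m < q → q ≤ m + a j' → ε q ≤ C * B (j' + 1))
    (hU : (a j : ℝ) * ∑ i ∈ Ico (j + 1) r, 4 * c i m * (C * B (i + 1)) ≤ (C - 1) * B (j + 1)) :
    (∀ q, m < q → q ≤ m + a j → ε q ≤ C * B (j + 1)) ∧ (1 - (a j : ℝ) * c j m * C) * B (j + 1) ≤ B j := by
  have hea' : ∀ p q, p ≤ q → e q ≤ e p := by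
    intro p q hpq
    induction q, hpq using Nat.le_induction with
    | base => exact le_rfl
    | succ q _ ih => exact (hea q).trans ih
  -- every read is non-negative at every pin `q ≥ m`
  have hOnn : ∀ i q, m ≤ q → 0 ≤ O i q := fun i q hq => by
    rw [hO]; exact sum_nonneg fun l _ => mul_nonneg (hw0 i q l) (IH _ (by omega)).1
  have hBj1 : 0 ≤ B (j + 1) := hBnn (j + 1) (by omega) (by omega)
  -- (I3): the targets of age `j` carry every older read, each of which has moved by ≤ 4c·a_j·C·B since the pin
  have htar : ∀ q, m < q → q ≤ m + a j → ε q ≤ C * B (j + 1) := by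
    intro q hmq hqa
    obtain ⟨d, rfl⟩ : ∃ d, q = m + d := ⟨q - m, by omega⟩
    have hd1 : 1 ≤ d := by omega
    have hda : d ≤ a j := by omega
    -- drop the reads of the ages ≤ j (non-negative) and use e_{m+d} ≤ e_m
    have h1 : ε (m + d) ≤ e m - ∑ i ∈ Ico (j + 1) r, O i (m + d) := by
      rw [hrec (m + d)]
      have hsplit := (sum_range_add_sum_Ico (fun i => O i (m + d)) (show j + 1 ≤ r by omega)).symm
      have hlow : 0 ≤ ∑ i ∈ range (j + 1), O i (m + d) := sum_nonneg fun i _ => hOnn i (m + d) (by omega)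
      have hem := hea' m (m + d) (by omega)
      rw [hsplit]; linarith
    -- each older read has moved by at most 4 c_i a_j C B(i+1)
    have h2 : ∑ i ∈ Ico (j + 1) r, (O i m - O i (m + d)) ≤ ∑ i ∈ Ico (j + 1) r, 4 * c i m * (a j : ℝ) * (C * B (i + 1)) := by
      refine sum_le_sum fun i hi => ?_
      have hi' := mem_Ico.mp hi
      have hdai : d ≤ a i := hda.trans (hamono i (by omega) hi'.2)
      have hTnn : 0 ≤ C * B (i + 1) := mul_nonneg (by linarith) (hBnn (i + 1) (by omega) (by omega))
      have hv := hvar i d (C * B (i + 1)) hi'.2 hd1 hdai hTnn (fun q hq => (IH q hq).1) (hT i (by omega) hi'.2)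
      have hdr : (d : ℝ) ≤ a j := by exact_mod_cast hda
      have h3 : 4 * c i m * (d : ℝ) * (C * B (i + 1)) ≤ 4 * c i m * (a j : ℝ) * (C * B (i + 1)) :=
        mul_le_mul_of_nonneg_right (mul_le_mul_of_nonneg_left hdr (by linarith [hc0 i m])) hTnn
      exact hv.trans h3
    have h3 : ∑ i ∈ Ico (j + 1) r, 4 * c i m * (a j : ℝ) * (C * B (i + 1))
        = (a j : ℝ) * ∑ i ∈ Ico (j + 1) r, 4 * c i m * (C * B (i + 1)) := by
      rw [mul_sum]; exact sum_congr rfl fun i _ => by ring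
    have h4 : ∑ i ∈ Ico (j + 1) r, O i (m + d) = ∑ i ∈ Ico (j + 1) r, O i m - ∑ i ∈ Ico (j + 1) r, (O i m - O i (m + d)) := by
      rw [← sum_sub_distrib]; exact sum_congr rfl fun i _ => by ring
    have hB1 := hB (j + 1)
    rw [h3] at h2
    rw [h4] at h1
    have : C * B (j + 1) = B (j + 1) + (C - 1) * B (j + 1) := by ring
    linarith [h1, h2, hU, hB1]
  refine ⟨htar, ?_⟩
  -- the peeling: O j m ≤ (row sum)·C·B(j+1) ≤ a_j c_j(m)·C·B(j+1), and B j = B(j+1) − O j m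
  have hOj : O j m ≤ (a j : ℝ) * c j m * (C * B (j + 1)) := by
    rw [hO]
    calc ∑ l ∈ range Kw, w j m l * ε (m + 1 + l) ≤ ∑ l ∈ range Kw, w j m l * (C * B (j + 1)) := by
          refine sum_le_sum fun l _ => ?_
          by_cases hl : l < a j
          · exact mul_le_mul_of_nonneg_left (htar (m + 1 + l) (by omega) (by omega)) (hw0 j m l)
          · rw [hwa j m l (not_lt.mp hl)]; simp
      _ = (∑ l ∈ range Kw, w j m l) * (C * B (j + 1)) := by rw [sum_mul]
      _ ≤ (a j : ℝ) * c j m * (C * B (j + 1)) :=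
          mul_le_mul_of_nonneg_right (hrow j m hjr) (mul_nonneg (by linarith) hBj1)
  have hBj : B j = B (j + 1) - O j m := by
    rw [hB j, hB (j + 1), sum_eq_sum_Ico_succ_bot hjr]; ring
  rw [hBj]
  nlinarith [hOj]

/-! ## §2 The cascade: `r` separated reads, every `r` -/

/-- **THE MULTIPLICATIVE RESIDUAL CASCADE (pure).**  `ε_q = e_q − Σ_{j<r} O j q` at every pin, `ε = 0` beyond the horizon `N`, `e ≥ 0` non-increasing;
the read of age `j < r` is `O j q = Σ_{l<Kw} w j q l·ε_{q+1+l}` with non-negative weights vanishing for `l ≥ a j` and row sums `≤ a_j·c_j(q)`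
(`c ≥ 0`), loads `a_j·c_j(q) ≤ s` for `j ≥ 1` and `a_0·c_0(q) ≤ s₀`; SEPARATION `R₀·a j ≤ a (j+1)`; RELATIVE VARIATION: for every age `j`, pin `m`,
`1 ≤ d ≤ a j` and `T ≥ 0`, if `ε ≥ 0` beyond `m` and the own targets `ε_q` (`m < q ≤ m + a j`) are `≤ T` then `O j m − O j (m+d) ≤ 4·c_j(m)·d·T`.
CLOSURE: `κ > 0`, `s ≥ 0`, `s₀(1+κ) ≤ 1`, `s(1+κ) < 1`, `κ + 4s(1+κ) ≤ R₀·(1 − s(1+κ))·κ`.  THEN `0 ≤ ε ≤ e` at every pin — for EVERY number of ages `r` and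
WHATEVER the total mass `s₀ + (r−1)s`.  (`κ = 1∕4`, `s = 0.6142`: `R₀ ≥ 58`; `s = s₀ = 0.7072`: `R₀ ≥ 131`.) [folklore] -/
theorem renewal_nonneg_cascade {r N Kw R₀ : ℕ} {κ s₀ s : ℝ} {a : ℕ → ℕ} {w : ℕ → ℕ → ℕ → ℝ} {c O : ℕ → ℕ → ℝ} {e ε : ℕ → ℝ}
    (hκ : 0 < κ) (hs : 0 ≤ s) (hs₀C : s₀ * (1 + κ) ≤ 1) (hsC : s * (1 + κ) < 1)
    (hR : κ + 4 * s * (1 + κ) ≤ (R₀ : ℝ) * (1 - s * (1 + κ)) * κ)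
    (ha : ∀ j, j + 1 < r → R₀ * a j ≤ a (j + 1))
    (hw0 : ∀ j q l, 0 ≤ w j q l) (hwa : ∀ j q l, a j ≤ l → w j q l = 0) (hc0 : ∀ j q, 0 ≤ c j q)
    (hrow : ∀ j q, j < r → ∑ l ∈ range Kw, w j q l ≤ (a j : ℝ) * c j q)
    (hcap0 : ∀ q, (a 0 : ℝ) * c 0 q ≤ s₀) (hcap : ∀ j q, 1 ≤ j → j < r → (a j : ℝ) * c j q ≤ s)
    (hO : ∀ j q, O j q = ∑ l ∈ range Kw, w j q l * ε (q + 1 + l))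
    (hvar : ∀ j m d (T : ℝ), j < r → 1 ≤ d → d ≤ a j → 0 ≤ T → (∀ q, m < q → 0 ≤ ε q) →
      (∀ q, m < q → q ≤ m + a j → ε q ≤ T) → O j m - O j (m + d) ≤ 4 * c j m * d * T)
    (he0 : ∀ q, 0 ≤ e q) (hea : ∀ q, e (q + 1) ≤ e q)
    (hεt : ∀ q, N < q → ε q = 0) (hrec : ∀ q, ε q = e q - ∑ j ∈ range r, O j q) : ∀ m, 0 ≤ ε m ∧ ε m ≤ e m := by
  -- downward induction from the horizon: it suffices to do one pin given the bounds beyond it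
  suffices step : ∀ m, (∀ q, m < q → 0 ≤ ε q ∧ ε q ≤ e q) → 0 ≤ ε m ∧ ε m ≤ e m by
    have main : ∀ n m, N < m + n → 0 ≤ ε m ∧ ε m ≤ e m := by
      intro n
      induction n with
      | zero => intro m hm; rw [hεt m (by omega)]; exact ⟨le_rfl, he0 m⟩
      | succ n ih => intro m hm; exact step m fun q hq => ih q (by omega)
    exact fun m => main (N + 1) m (by omega)
  intro m IH
  have hOnn : ∀ i q, m ≤ q → 0 ≤ O i q := fun i q hq => by
    rw [hO]; exact sum_nonneg fun l _ => mul_nonneg (hw0 i q l) (IH _ (by omega)).1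
  have hsum0 : 0 ≤ ∑ j ∈ range r, O j m := sum_nonneg fun j _ => hOnn j m le_rfl
  refine ⟨?_, by rw [hrec m]; linarith⟩
  -- constants
  set C : ℝ := 1 + κ with hC_def
  have hC1 : 1 ≤ C := by rw [hC_def]; linarith
  set lam : ℝ := 1 - s * C with hlam_def
  have hlam0 : 0 < lam := by rw [hlam_def, hC_def]; linarith
  have hR0 : (0 : ℝ) < R₀ := by
    have h1 : 0 < κ + 4 * s * (1 + κ) := by positivity
    by_contra h0
    have : (R₀ : ℝ) ≤ 0 := not_lt.mp h0
    have hR0' : (R₀ : ℝ) = 0 := le_antisymm this (Nat.cast_nonneg R₀)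
    rw [hR0'] at hR
    linarith
  have hR1 : 1 ≤ R₀ := by exact_mod_cast (show (0 : ℝ) < R₀ from hR0)
  -- window lengths are monotone along the separated chain
  have hamono : ∀ j j', j ≤ j' → j' < r → a j ≤ a j' := by
    intro j j' hjj' hj'r
    induction j', hjj' using Nat.le_induction with
    | base => exact le_rfl
    | succ j' hle ih =>
      have h1 := ih (by omega)
      have h2 := ha j' hj'r
      have h3 : a j' ≤ R₀ * a j' := Nat.le_mul_of_pos_left _ (by omega)
      omega
  -- the residuals and the variation rates (opaque names with defining equations)
  obtain ⟨B, hB⟩ : ∃ B : ℕ → ℝ, ∀ j, B j = e m - ∑ i ∈ Ico j r, O i m := ⟨_, fun _ => rfl⟩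
  obtain ⟨U, hU⟩ : ∃ U : ℕ → ℝ, ∀ j, U j = ∑ i ∈ Ico (j + 1) r, 4 * c i m * (C * B (i + 1)) := ⟨_, fun _ => rfl⟩
  have hBr : B r = e m := by rw [hB, Ico_self, sum_empty, sub_zero]
  have hB0 : B 0 = ε m := by rw [hB, hrec m, range_eq_Ico]
  have hBle : ∀ j, j < r → B j ≤ B (j + 1) := fun j hj => by
    rw [hB j, hB (j + 1), sum_eq_sum_Ico_succ_bot hj]; linarith [hOnn j m le_rfl]
  -- the case of no age at all
  rcases Nat.eq_zero_or_pos r with hr0 | hrpos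
  · rw [hr0] at hBr; rw [← hB0, hBr]; exact he0 m
  -- one level, packaged
  have level : ∀ j, j < r → (∀ j', j < j' → j' ≤ r → 0 ≤ B j') →
      (∀ j', j < j' → j' < r → ∀ q, m < q → q ≤ m + a j' → ε q ≤ C * B (j' + 1)) →
      (a j : ℝ) * U j ≤ κ * B (j + 1) →
      (∀ q, m < q → q ≤ m + a j → ε q ≤ C * B (j + 1)) ∧ (1 - (a j : ℝ) * c j m * C) * B (j + 1) ≤ B j := by
    intro j hjr hBnn hT hUj
    have hU' : (a j : ℝ) * ∑ i ∈ Ico (j + 1) r, 4 * c i m * (C * B (i + 1)) ≤ (C - 1) * B (j + 1) := by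
      rw [← hU j, hC_def]; linarith
    exact cascade_level hjr hC1 hw0 hwa hc0 hrow hO (fun j' hjj' hj'r => hamono j j' hjj'.le hj'r) (fun j' d T => hvar j' m d T)
      hea hrec IH hB hBnn hT hU'
  -- THE DESCENT from j = r to j = 1
  have main : ∀ n j, j + n = r → 1 ≤ j →
      (∀ j', j ≤ j' → j' ≤ r → 0 ≤ B j') ∧
      (∀ j', j ≤ j' → j' < r → ∀ q, m < q → q ≤ m + a j' → ε q ≤ C * B (j' + 1)) ∧
      ((a (j - 1) : ℝ) * U (j - 1) ≤ κ * B j) := by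
    intro n
    induction n with
    | zero =>
      intro j hj hj1
      rw [add_zero] at hj
      subst hj
      refine ⟨fun j' h1 h2 => ?_, fun j' h1 h2 => absurd h2 (not_lt.mpr h1), ?_⟩
      · rw [show j' = j from le_antisymm h2 h1, hBr]; exact he0 m
      · rw [hU, show j - 1 + 1 = j from Nat.sub_add_cancel hj1, Ico_self, sum_empty, mul_zero, hBr]
        exact mul_nonneg hκ.le (he0 m)
    | succ n ih =>
      intro j hj hj1
      obtain ⟨hBnn, hT, hUj⟩ := ih (j + 1) (by omega) (by omega)
      have hjr : j < r := by omega
      rw [Nat.add_sub_cancel] at hUj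
      obtain ⟨htar, hpeel⟩ := level j hjr (fun j' h1 h2 => hBnn j' (by omega) h2) (fun j' h1 h2 => hT j' (by omega) h2) hUj
      have hBj1 : 0 ≤ B (j + 1) := hBnn (j + 1) le_rfl (by omega)
      -- the load of age j ≥ 1 is ≤ s, so B j ≥ λ B(j+1)
      have hx : (a j : ℝ) * c j m ≤ s := hcap j m hj1 hjr
      have hx0 : 0 ≤ (a j : ℝ) * c j m := mul_nonneg (Nat.cast_nonneg _) (hc0 j m)
      have hBj : lam * B (j + 1) ≤ B j := by
        have h1 : lam ≤ 1 - (a j : ℝ) * c j m * C := by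
          rw [hlam_def]; nlinarith [mul_le_mul_of_nonneg_right hx (show (0:ℝ) ≤ C by linarith)]
        exact (mul_le_mul_of_nonneg_right h1 hBj1).trans hpeel
      have hBj0 : 0 ≤ B j := le_trans (mul_nonneg hlam0.le hBj1) hBj
      refine ⟨fun j' h1 h2 => ?_, fun j' h1 h2 => ?_, ?_⟩
      · by_cases hj' : j' = j
        · rw [hj']; exact hBj0
        · exact hBnn j' (by omega) h2
      · by_cases hj' : j' = j
        · subst hj'; exact htar
        · exact hT j' (by omega) h2
      · -- the variation rate one level down: a_{j−1} U_{j−1} ≤ (a_j∕R₀)(U_j + 4 c_j C B(j+1)) ≤ (κ + 4sC)∕R₀·B(j+1) ≤ κ B j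
        have hUsplit : U (j - 1) = 4 * c j m * (C * B (j + 1)) + U j := by
          rw [hU (j - 1), hU j, Nat.sub_add_cancel hj1, sum_eq_sum_Ico_succ_bot hjr]
        have haj : (R₀ : ℝ) * a (j - 1) ≤ a j := by
          have := ha (j - 1) (by omega)
          rw [Nat.sub_add_cancel hj1] at this
          exact_mod_cast this
        have hU0 : 0 ≤ U (j - 1) := by
          rw [hUsplit, hU j]
          have hC0 : (0 : ℝ) ≤ C := by linarith
          refine add_nonneg (mul_nonneg (mul_nonneg (by norm_num) (hc0 j m)) (mul_nonneg hC0 hBj1)) ?_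
          exact sum_nonneg fun i hi => mul_nonneg (mul_nonneg (by norm_num) (hc0 i m))
            (mul_nonneg hC0 (hBnn (i + 1) (by have := (mem_Ico.mp hi).1; omega) (by have := (mem_Ico.mp hi).2; omega)))
        -- R₀·(a_{j−1} U_{j−1}) ≤ a_j U_{j−1} = 4 (a_j c_j) C B(j+1) + a_j U_j ≤ (4 s C + κ) B(j+1)
        have h1 : (R₀ : ℝ) * ((a (j - 1) : ℝ) * U (j - 1)) ≤ (κ + 4 * s * C) * B (j + 1) := by
          calc (R₀ : ℝ) * ((a (j - 1) : ℝ) * U (j - 1)) = ((R₀ : ℝ) * a (j - 1)) * U (j - 1) := by ring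
            _ ≤ (a j : ℝ) * U (j - 1) := mul_le_mul_of_nonneg_right haj hU0
            _ = 4 * ((a j : ℝ) * c j m) * (C * B (j + 1)) + (a j : ℝ) * U j := by rw [hUsplit]; ring
            _ ≤ 4 * s * (C * B (j + 1)) + κ * B (j + 1) := by
                have hCB : 0 ≤ C * B (j + 1) := mul_nonneg (by linarith) hBj1
                have := mul_le_mul_of_nonneg_right hx hCB
                linarith
            _ = (κ + 4 * s * C) * B (j + 1) := by ring
        -- (κ + 4sC) B(j+1) ≤ R₀ λ κ B(j+1) ≤ R₀ κ B j
        have h2 : (κ + 4 * s * C) * B (j + 1) ≤ (R₀ : ℝ) * (κ * B j) := by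
          have hR' : κ + 4 * s * C ≤ (R₀ : ℝ) * lam * κ := by rw [hC_def, hlam_def, hC_def]; exact hR
          calc (κ + 4 * s * C) * B (j + 1) ≤ (R₀ : ℝ) * lam * κ * B (j + 1) := mul_le_mul_of_nonneg_right hR' hBj1
            _ = (R₀ : ℝ) * (κ * (lam * B (j + 1))) := by ring
            _ ≤ (R₀ : ℝ) * (κ * B j) := mul_le_mul_of_nonneg_left (mul_le_mul_of_nonneg_left hBj hκ.le) hR0.le
        exact le_of_mul_le_mul_left (h1.trans h2) hR0
  -- THE LAST LEVEL: the youngest age needs only s₀ C ≤ 1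
  obtain ⟨hBnn, hT, hU0⟩ := main (r - 1) 1 (by omega) le_rfl
  rw [Nat.sub_self] at hU0
  obtain ⟨-, hpeel⟩ := level 0 hrpos (fun j' h1 h2 => hBnn j' (by omega) h2) (fun j' h1 h2 => hT j' (by omega) h2) hU0
  have hB1 : 0 ≤ B 1 := hBnn 1 le_rfl (by omega)
  have hx : (a 0 : ℝ) * c 0 m ≤ s₀ := hcap0 m
  have h1 : 0 ≤ 1 - (a 0 : ℝ) * c 0 m * C := by
    rw [hC_def]; nlinarith [mul_le_mul_of_nonneg_right hx (show (0:ℝ) ≤ 1 + κ by linarith)]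
  rw [← hB0]
  exact le_trans (mul_nonneg h1 hB1) hpeel

end Summit.QuantumFields.BalabanUV.Beta.EriceRemainderEnclosureHistoryAutonomyComparisonAgeCompositionCascade

end
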